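import Summits.AtomisticToContinuum.FouriersLaw.Theorems.BondHeatUncertaintyBoundedResponseBathHeatCumulantA
import HarnessLib

/-!
# Bounded response, bath heat: WickDefect / CumulantChannels (lens-1 NODE 108) — part 2 of 5 (sequel of `…BondHeatUncertaintyBoundedResponseBathHeatCumulantA`)

Split for the 400-line cap by the landing lane (hand-2 g39); the module docstring of part 1 (`…BondHeatUncertaintyBoundedResponseBathHeatCumulantA`) describes the whole node.  Same namespace; all FQNs unchanged.
0 sorry; standard axioms.
-/

noncomputable section
open MeasureTheory ProbabilityTheory Filter Topology Set Function
open scoped NNReal ENNReal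
open Literature.MathematicalPhysics.KineticTheory.HeatConduction
open Literature.MathematicalPhysics.KineticTheory OscillatorChain
open Literature.Probability.Process
open Summit.AtomisticToContinuum.FouriersLaw.Theorems.SubdiffusiveBondHeat
open Summit.AtomisticToContinuum.FouriersLaw.Theorems.SubdiffusiveBondHeat.EscapeGrading
open Summit.AtomisticToContinuum.FouriersLaw.Theorems.IncoherentChannel.Negative.KernelMoments
  (integrable_sq_momentum_transitionKernel harmonic_kernel_momentum harmonic_kernel_momentum_sq)
open Summit.AtomisticToContinuum.FouriersLaw.Theorems.IncoherentChannel.Negative.HarmonicFlow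
  (harmonic_chainFlow_zero_noise_linear integral_gibbsMeasure_eq_zero_of_odd)
open Summit.AtomisticToContinuum.FouriersLaw.Theorems.IncoherentChannel.Negative.GibbsStein
  (integrable_gibbsMeasure_of_growth pow_le_one_add_sq_sq gibbs_sq_momentum gibbs_momentum_mul_clm gibbs_sq_momentum_mul_clm_sq)
open Summit.AtomisticToContinuum.FouriersLaw.Cruxes.SuperadditiveResistance.FloatingProbeBypassLaplacian
  (integral_flip_gibbsMeasure integrable_flip_gibbsMeasure)

namespace Summit.AtomisticToContinuum.FouriersLaw.Theorems.BoundedResponse.HeatSpreading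

open Summit.AtomisticToContinuum.FouriersLaw.Theses.BondHeatUncertainty (BoundedResponse SubdiffusiveBondHeat)
open Summit.AtomisticToContinuum.FouriersLaw.Theorems.BoundedResponse.TransientBand
  (escapeKernel escapeTransient warburgDip TransientFloor WarburgDipFloor transientFloor_one_of_warburgDipFloor)

/-! ### Toolbox: the momentum forecast `m_t`, the energy forecast `G_t`, their moments under `μ_T` -/

/-- `z ↦ m_t(z) = ∫ p₀ dP_t(z,·)` is measurable. [folklore] -/
theorem measurable_momFcast (ω₂ lam β γ T : ℝ) (n : ℕ) (t : ℝ≥0) :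
    Measurable fun z : PhaseSpace (n + 1) => ∫ y, y.2 0 ∂((pinnedChain ω₂ lam β γ).transitionKernel (n + 1) T T t z) := by
  have h : StronglyMeasurable fun y : PhaseSpace (n + 1) => y.2 0 :=
    (by fun_prop : Measurable fun y : PhaseSpace (n + 1) => y.2 0).stronglyMeasurable
  exact (h.integral_kernel (κ := (pinnedChain ω₂ lam β γ).transitionKernel (n + 1) T T t)).measurable

/-- `z ↦ G_t(z) = ∫ p₀² dP_t(z,·)` is measurable. [folklore] -/
theorem measurable_kinFcastG (ω₂ lam β γ T : ℝ) (n : ℕ) (t : ℝ≥0) :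
    Measurable fun z : PhaseSpace (n + 1) => ∫ y, y.2 0 ^ 2 ∂((pinnedChain ω₂ lam β γ).transitionKernel (n + 1) T T t z) := by
  have h : StronglyMeasurable fun y : PhaseSpace (n + 1) => y.2 0 ^ 2 :=
    (by fun_prop : Measurable fun y : PhaseSpace (n + 1) => y.2 0 ^ 2).stronglyMeasurable
  exact (h.integral_kernel (κ := (pinnedChain ω₂ lam β γ).transitionKernel (n + 1) T T t)).measurable

section Moments

variable {ω₂ lam β γ : ℝ} (hω : 0 < ω₂) (hl : 0 < lam) (hβ : 0 < β) (hγ : 0 < γ) {T : ℝ} (hT : 0 < T)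
include hω hl hβ hγ hT

/-- **Kernel Jensen**: `m_t(z)² ≤ G_t(z)` for EVERY microstate `z`, i.e. the conditional variance `V_t(z) ≥ 0` (`p₀² ∈ L¹(P_t(z,·))`, CEHR (3.4)).
[folklore] -/
theorem momFcast_sq_le_kinFcast (n : ℕ) (t : ℝ≥0) (z : PhaseSpace (n + 1)) :
    (∫ y, y.2 0 ∂((pinnedChain ω₂ lam β γ).transitionKernel (n + 1) T T t z)) ^ 2 ≤
      ∫ y, y.2 0 ^ 2 ∂((pinnedChain ω₂ lam β γ).transitionKernel (n + 1) T T t z) := by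
  haveI := pinnedChain_isMarkovKernel_transitionKernel hω hl.le hβ.le hγ.le (n + 1) T T t
  exact PhononMeanFreePath.lightCone_sq_integral_le
    (by fun_prop : Measurable fun y : PhaseSpace (n + 1) => y.2 0).aestronglyMeasurable
    (integrable_sq_momentum_transitionKernel hω hl.le hβ.le hγ.le (Nat.succ_pos n) hT t z 0)

omit hT in
/-- **Two-replica form of the squared forecast** (the basis of the no-nesting instrument FORK-108): `m_t(z)² = ∫ p₀(y₁)·p₀(y₂) d(P_t(z,·) ⊗ P_t(z,·))`
— two bath-noise replicas forked from the same microstate `z`. [folklore] -/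
theorem momFcast_sq_eq_twoReplica (n : ℕ) (t : ℝ≥0) (z : PhaseSpace (n + 1)) :
    (∫ y, y.2 0 ∂((pinnedChain ω₂ lam β γ).transitionKernel (n + 1) T T t z)) ^ 2 =
      ∫ w, w.1.2 0 * w.2.2 0 ∂(((pinnedChain ω₂ lam β γ).transitionKernel (n + 1) T T t z).prod
        ((pinnedChain ω₂ lam β γ).transitionKernel (n + 1) T T t z)) := by
  haveI := pinnedChain_isMarkovKernel_transitionKernel hω hl.le hβ.le hγ.le (n + 1) T T t
  rw [integral_prod_mul (fun y : PhaseSpace (n + 1) => y.2 0) (fun y : PhaseSpace (n + 1) => y.2 0), sq]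

/-- `G_t ∈ L¹(μ_T)` and `∫ G_t dμ_T = T` (invariance of `μ_T`, `∫ p₀² dμ_T = T`). [folklore] -/
theorem integrable_kinFcastG_and_integral (n : ℕ) (t : ℝ≥0) :
    Integrable (fun z : PhaseSpace (n + 1) => ∫ y, y.2 0 ^ 2 ∂((pinnedChain ω₂ lam β γ).transitionKernel (n + 1) T T t z))
        ((pinnedChain ω₂ lam β γ).gibbsMeasure (n + 1) T) ∧
      ∫ z, (∫ y, y.2 0 ^ 2 ∂((pinnedChain ω₂ lam β γ).transitionKernel (n + 1) T T t z))
          ∂((pinnedChain ω₂ lam β γ).gibbsMeasure (n + 1) T) = T := by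
  have h := PhononMeanFreePath.lightCone_integrable_kernel_integral hω hl.le hβ.le hγ.le hT t
    (by fun_prop : Measurable fun y : PhaseSpace (n + 1) => y.2 0 ^ 2) (fun y => sq_nonneg _)
    (PhononMeanFreePath.lightCone_integrable_momentum_pow (γ := γ) hω hl.le hβ.le hT (0 : Fin (n + 1)) 2)
  refine ⟨h.1, ?_⟩
  rw [h.2]
  exact pinnedChain_integral_sq_momentum_gibbsMeasure hω hl.le hβ.le γ (n + 1) hT (0 : Fin (n + 1))

/-- `G_t² ∈ L¹(μ_T)` (`L²`-contraction of `P_t` on `p₀²`, `p₀⁴ ∈ L¹(μ_T)`). [folklore] -/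
theorem integrable_sq_kinFcastG (n : ℕ) (t : ℝ≥0) :
    Integrable (fun z : PhaseSpace (n + 1) => (∫ y, y.2 0 ^ 2 ∂((pinnedChain ω₂ lam β γ).transitionKernel (n + 1) T T t z)) ^ 2)
      ((pinnedChain ω₂ lam β γ).gibbsMeasure (n + 1) T) := by
  have h4 : Integrable (fun z : PhaseSpace (n + 1) => (z.2 0 ^ 2) ^ 2) ((pinnedChain ω₂ lam β γ).gibbsMeasure (n + 1) T) :=
    (PhononMeanFreePath.lightCone_integrable_momentum_pow (γ := γ) hω hl.le hβ.le hT (0 : Fin (n + 1)) 4).congr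
      (Eventually.of_forall fun z => by ring)
  exact (pinnedChain_sq_act_le_of_sq_integrable hω hl hβ hγ (Nat.succ_pos n) hT
    (by fun_prop : Measurable fun y : PhaseSpace (n + 1) => y.2 0 ^ 2) h4 t).2.1

/-- `m_t² ∈ L¹(μ_T)` and `‖m_t‖²_{L²(μ_T)} ≤ T` (`L²`-contraction of `P_t` on `p₀`). [folklore] -/
theorem integrable_sq_momFcast_and_le (n : ℕ) (t : ℝ≥0) :
    Integrable (fun z : PhaseSpace (n + 1) => (∫ y, y.2 0 ∂((pinnedChain ω₂ lam β γ).transitionKernel (n + 1) T T t z)) ^ 2)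
        ((pinnedChain ω₂ lam β γ).gibbsMeasure (n + 1) T) ∧
      ∫ z, (∫ y, y.2 0 ∂((pinnedChain ω₂ lam β γ).transitionKernel (n + 1) T T t z)) ^ 2
          ∂((pinnedChain ω₂ lam β γ).gibbsMeasure (n + 1) T) ≤ T := by
  have h2 := PhononMeanFreePath.lightCone_integrable_momentum_pow (γ := γ) hω hl.le hβ.le hT (0 : Fin (n + 1)) 2
  have h := pinnedChain_sq_act_le_of_sq_integrable hω hl hβ hγ (Nat.succ_pos n) hT
    (by fun_prop : Measurable fun y : PhaseSpace (n + 1) => y.2 0) h2 t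
  refine ⟨h.2.1, ?_⟩
  have hT' := pinnedChain_integral_sq_momentum_gibbsMeasure hω hl.le hβ.le γ (n + 1) hT (0 : Fin (n + 1))
  exact h.2.2.trans hT'.le

/-- `(p₀² − T)·G_t ∈ L¹(μ_T)` (`|θG| ≤ (θ² + G²)/2`). [folklore] -/
theorem integrable_kinObs_mul_kinFcastG (n : ℕ) (t : ℝ≥0) :
    Integrable (fun z : PhaseSpace (n + 1) => (z.2 0 ^ 2 - T) *
        ∫ y, y.2 0 ^ 2 ∂((pinnedChain ω₂ lam β γ).transitionKernel (n + 1) T T t z))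
      ((pinnedChain ω₂ lam β γ).gibbsMeasure (n + 1) T) := by
  have hθ2 := PhononMeanFreePath.kinAutocov_integrable_sq_kinObs (γ := γ) hω hT hl.le hβ.le n
  have hG2 := integrable_sq_kinFcastG hω hl hβ hγ hT n t
  have hm : Measurable fun z : PhaseSpace (n + 1) => (z.2 0 ^ 2 - T) *
      ∫ y, y.2 0 ^ 2 ∂((pinnedChain ω₂ lam β γ).transitionKernel (n + 1) T T t z) :=
    (by fun_prop : Measurable fun z : PhaseSpace (n + 1) => z.2 0 ^ 2 - T).mul (measurable_kinFcastG ω₂ lam β γ T n t)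
  refine (((hθ2.add hG2)).div_const 2).mono' hm.aestronglyMeasurable (Eventually.of_forall fun z => ?_)
  rw [Real.norm_eq_abs, abs_mul]
  simp only [Pi.add_apply]
  nlinarith [sq_nonneg (|z.2 0 ^ 2 - T| - |∫ y, y.2 0 ^ 2 ∂((pinnedChain ω₂ lam β γ).transitionKernel (n + 1) T T t z)|),
    sq_abs (z.2 0 ^ 2 - T), sq_abs (∫ y, y.2 0 ^ 2 ∂((pinnedChain ω₂ lam β γ).transitionKernel (n + 1) T T t z))]

/-- `(p₀² − T)·m_t² ∈ L¹(μ_T)` (`0 ≤ m_t² ≤ G_t`, previous lemma's domination). [folklore] -/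
theorem integrable_kinObs_mul_sq_momFcast (n : ℕ) (t : ℝ≥0) :
    Integrable (fun z : PhaseSpace (n + 1) => (z.2 0 ^ 2 - T) *
        (∫ y, y.2 0 ∂((pinnedChain ω₂ lam β γ).transitionKernel (n + 1) T T t z)) ^ 2)
      ((pinnedChain ω₂ lam β γ).gibbsMeasure (n + 1) T) := by
  have hθ2 := PhononMeanFreePath.kinAutocov_integrable_sq_kinObs (γ := γ) hω hT hl.le hβ.le n
  have hG2 := integrable_sq_kinFcastG hω hl hβ hγ hT n t
  have hm : Measurable fun z : PhaseSpace (n + 1) => (z.2 0 ^ 2 - T) *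
      (∫ y, y.2 0 ∂((pinnedChain ω₂ lam β γ).transitionKernel (n + 1) T T t z)) ^ 2 :=
    (by fun_prop : Measurable fun z : PhaseSpace (n + 1) => z.2 0 ^ 2 - T).mul ((measurable_momFcast ω₂ lam β γ T n t).pow_const 2)
  refine (((hθ2.add hG2)).div_const 2).mono' hm.aestronglyMeasurable (Eventually.of_forall fun z => ?_)
  have hJ := momFcast_sq_le_kinFcast hω hl hβ hγ hT n t z
  have hm0 : 0 ≤ (∫ y, y.2 0 ∂((pinnedChain ω₂ lam β γ).transitionKernel (n + 1) T T t z)) ^ 2 := sq_nonneg _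
  rw [Real.norm_eq_abs, abs_mul, abs_of_nonneg hm0]
  simp only [Pi.add_apply]
  have hG0 : 0 ≤ ∫ y, y.2 0 ^ 2 ∂((pinnedChain ω₂ lam β γ).transitionKernel (n + 1) T T t z) := hm0.trans hJ
  nlinarith [sq_nonneg (|z.2 0 ^ 2 - T| - (∫ y, y.2 0 ^ 2 ∂((pinnedChain ω₂ lam β γ).transitionKernel (n + 1) T T t z))),
    sq_abs (z.2 0 ^ 2 - T), abs_nonneg (z.2 0 ^ 2 - T)]

/-- `p₀·m_t ∈ L¹(μ_T)` (`2|p₀ m_t| ≤ p₀² + m_t²`). [folklore] -/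
theorem integrable_mom_mul_momFcast (n : ℕ) (t : ℝ≥0) :
    Integrable (fun z : PhaseSpace (n + 1) => z.2 0 *
        ∫ y, y.2 0 ∂((pinnedChain ω₂ lam β γ).transitionKernel (n + 1) T T t z))
      ((pinnedChain ω₂ lam β γ).gibbsMeasure (n + 1) T) := by
  have h2 := PhononMeanFreePath.lightCone_integrable_momentum_pow (γ := γ) hω hl.le hβ.le hT (0 : Fin (n + 1)) 2
  have hm2 := (integrable_sq_momFcast_and_le hω hl hβ hγ hT n t).1
  have hm : Measurable fun z : PhaseSpace (n + 1) => z.2 0 *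
      ∫ y, y.2 0 ∂((pinnedChain ω₂ lam β γ).transitionKernel (n + 1) T T t z) :=
    (by fun_prop : Measurable fun z : PhaseSpace (n + 1) => z.2 0).mul (measurable_momFcast ω₂ lam β γ T n t)
  refine (((h2.add hm2)).div_const 2).mono' hm.aestronglyMeasurable (Eventually.of_forall fun z => ?_)
  rw [Real.norm_eq_abs, abs_mul]
  simp only [Pi.add_apply]
  nlinarith [sq_nonneg (|z.2 0| - |∫ y, y.2 0 ∂((pinnedChain ω₂ lam β γ).transitionKernel (n + 1) T T t z)|),
    sq_abs (z.2 0), sq_abs (∫ y, y.2 0 ∂((pinnedChain ω₂ lam β γ).transitionKernel (n + 1) T T t z))]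

/-- **`|c_N(u)| ≤ T`** (`N ≥ 1`): `2|p₀ m_u| ≤ p₀² + m_u²`, `∫ p₀² = T`, `∫ m_u² ≤ T`. Hence the Gaussian part `2c_N² ≤ 2T²` like `|K_N| ≤ 2T²`.
[folklore] -/
theorem abs_bathMomCorr_le {N : ℕ} (hN : 0 < N) (u : ℝ) : |bathMomCorr ω₂ lam β γ T N u| ≤ T := by
  obtain ⟨n, rfl⟩ : ∃ n, N = n + 1 := ⟨N - 1, by omega⟩
  have h2 := PhononMeanFreePath.lightCone_integrable_momentum_pow (γ := γ) hω hl.le hβ.le hT (0 : Fin (n + 1)) 2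
  have hp2 := pinnedChain_integral_sq_momentum_gibbsMeasure hω hl.le hβ.le γ (n + 1) hT (0 : Fin (n + 1))
  obtain ⟨hm2, hm2le⟩ := integrable_sq_momFcast_and_le hω hl hβ hγ hT n u.toNNReal
  have hpm := integrable_mom_mul_momFcast hω hl hβ hγ hT n u.toNNReal
  unfold bathMomCorr
  rw [dif_pos (Nat.succ_pos n)]
  refine (abs_integral_le_integral_abs).trans ?_
  have hle : ∫ z, |z.2 0 * ∫ y, y.2 0 ∂((pinnedChain ω₂ lam β γ).transitionKernel (n + 1) T T u.toNNReal z)|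
      ∂((pinnedChain ω₂ lam β γ).gibbsMeasure (n + 1) T) ≤
      ∫ z, (z.2 0 ^ 2 + (∫ y, y.2 0 ∂((pinnedChain ω₂ lam β γ).transitionKernel (n + 1) T T u.toNNReal z)) ^ 2) / 2
      ∂((pinnedChain ω₂ lam β γ).gibbsMeasure (n + 1) T) := by
    refine integral_mono hpm.abs ((h2.add hm2).div_const 2) fun z => ?_
    dsimp only
    rw [abs_mul]
    nlinarith [sq_nonneg (|z.2 0| - |∫ y, y.2 0 ∂((pinnedChain ω₂ lam β γ).transitionKernel (n + 1) T T u.toNNReal z)|),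
      sq_abs (z.2 0), sq_abs (∫ y, y.2 0 ∂((pinnedChain ω₂ lam β γ).transitionKernel (n + 1) T T u.toNNReal z))]
  refine hle.trans ?_
  rw [integral_div, integral_add h2 hm2, hp2]
  linarith

/-- **Law of total variance**: `E_{μ_T}[V_t] = ∫ (G_t − m_t²) dμ_T = T − ‖m_t‖²_{L²(μ_T)}` (`N = n+1 ≥ 1`). [folklore] -/
theorem integral_condVar_eq (n : ℕ) (t : ℝ≥0) :
    ∫ z, ((∫ y, y.2 0 ^ 2 ∂((pinnedChain ω₂ lam β γ).transitionKernel (n + 1) T T t z)) -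
        (∫ y, y.2 0 ∂((pinnedChain ω₂ lam β γ).transitionKernel (n + 1) T T t z)) ^ 2)
      ∂((pinnedChain ω₂ lam β γ).gibbsMeasure (n + 1) T) =
      T - ∫ z, (∫ y, y.2 0 ∂((pinnedChain ω₂ lam β γ).transitionKernel (n + 1) T T t z)) ^ 2
        ∂((pinnedChain ω₂ lam β γ).gibbsMeasure (n + 1) T) := by
  obtain ⟨hG, hGT⟩ := integrable_kinFcastG_and_integral hω hl hβ hγ hT n t
  rw [integral_sub hG (integrable_sq_momFcast_and_le hω hl hβ hγ hT n t).1, hGT]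

/-- `K_N(t) = ∫ (p₀² − T)·G_t dμ_T` (`P_t(z,·)` is a probability, `∫ (p₀² − T) dμ_T = 0`). [folklore] -/
theorem bathKinCorr_eq_integral_kinObs_mul_kinFcastG (n : ℕ) (t : ℝ) :
    bathKinCorr ω₂ lam β γ T (n + 1) t =
      ∫ z, (z.2 0 ^ 2 - T) * ∫ y, y.2 0 ^ 2 ∂((pinnedChain ω₂ lam β γ).transitionKernel (n + 1) T T t.toNNReal z)
        ∂((pinnedChain ω₂ lam β γ).gibbsMeasure (n + 1) T) := by
  haveI := pinnedChain_isProbabilityMeasure_gibbsMeasure hω hl.le hβ.le γ (n + 1) hT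
  have h2 := PhononMeanFreePath.lightCone_integrable_momentum_pow (γ := γ) hω hl.le hβ.le hT (0 : Fin (n + 1)) 2
  have hp2 := pinnedChain_integral_sq_momentum_gibbsMeasure hω hl.le hβ.le γ (n + 1) hT (0 : Fin (n + 1))
  have hθG := integrable_kinObs_mul_kinFcastG hω hl hβ hγ hT n t.toNNReal
  have hθ : Integrable (fun z : PhaseSpace (n + 1) => (z.2 0 ^ 2 - T) * T) ((pinnedChain ω₂ lam β γ).gibbsMeasure (n + 1) T) :=
    (h2.sub (integrable_const T)).mul_const T
  have hθ0 : ∫ z, (z.2 0 ^ 2 - T) * T ∂((pinnedChain ω₂ lam β γ).gibbsMeasure (n + 1) T) = 0 := by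
    rw [integral_mul_const, integral_sub h2 (integrable_const T), integral_const, probReal_univ, one_smul, hp2]
    ring
  unfold bathKinCorr
  rw [dif_pos (Nat.succ_pos n)]
  have h1 : ∫ z, (z.2 (⟨0, Nat.succ_pos n⟩ : Fin (n + 1)) ^ 2 - T) *
      (∫ y, (y.2 (⟨0, Nat.succ_pos n⟩ : Fin (n + 1)) ^ 2 - T) ∂((pinnedChain ω₂ lam β γ).transitionKernel (n + 1) T T t.toNNReal z))
      ∂((pinnedChain ω₂ lam β γ).gibbsMeasure (n + 1) T) =
      ∫ z, (z.2 0 ^ 2 - T) * (∫ y, y.2 0 ^ 2 ∂((pinnedChain ω₂ lam β γ).transitionKernel (n + 1) T T t.toNNReal z)) -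
        (z.2 0 ^ 2 - T) * T ∂((pinnedChain ω₂ lam β γ).gibbsMeasure (n + 1) T) := by
    refine integral_congr_ae (Eventually.of_forall fun z => ?_)
    have hk := PhononMeanFreePath.kinAutocov_kinFcast_eq (γ := γ) hω hT hl.le hβ.le hγ.le n t.toNNReal z
    change (z.2 0 ^ 2 - T) * (∫ y, (y.2 0 ^ 2 - T) ∂((pinnedChain ω₂ lam β γ).transitionKernel (n + 1) T T t.toNNReal z)) = _
    rw [hk]; ring
  rw [h1, integral_sub hθG hθ, hθ0, sub_zero]

/-- ★ **CHANNEL SPLIT (exact)**: `K_N(t) = CP_N(t) + VC_N(t)` for `N ≥ 1` and every `t` — `P_t(p₀² − T) = m_t² + V_t − T` and `E_{μ_T}[p₀² − T] = 0`.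
[this cell] -/
theorem bathKinCorr_eq_commonPast_add_varChannel {N : ℕ} (hN : 0 < N) (t : ℝ) :
    bathKinCorr ω₂ lam β γ T N t = bathCommonPast ω₂ lam β γ T N t + bathVarChannel ω₂ lam β γ T N t := by
  obtain ⟨n, rfl⟩ : ∃ n, N = n + 1 := ⟨N - 1, by omega⟩
  have hθG := integrable_kinObs_mul_kinFcastG hω hl hβ hγ hT n t.toNNReal
  have hθm := integrable_kinObs_mul_sq_momFcast hω hl hβ hγ hT n t.toNNReal
  rw [bathKinCorr_eq_integral_kinObs_mul_kinFcastG hω hl hβ hγ hT n t]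
  unfold bathCommonPast bathVarChannel
  rw [dif_pos (Nat.succ_pos n), dif_pos (Nat.succ_pos n)]
  change _ = (∫ z, (z.2 0 ^ 2 - T) * (∫ y, y.2 0 ∂((pinnedChain ω₂ lam β γ).transitionKernel (n + 1) T T t.toNNReal z)) ^ 2
      ∂((pinnedChain ω₂ lam β γ).gibbsMeasure (n + 1) T)) +
    ∫ z, (z.2 0 ^ 2 - T) * ((∫ y, y.2 0 ^ 2 ∂((pinnedChain ω₂ lam β γ).transitionKernel (n + 1) T T t.toNNReal z)) -
      (∫ y, y.2 0 ∂((pinnedChain ω₂ lam β γ).transitionKernel (n + 1) T T t.toNNReal z)) ^ 2)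
      ∂((pinnedChain ω₂ lam β γ).gibbsMeasure (n + 1) T)
  have hV : Integrable (fun z : PhaseSpace (n + 1) => (z.2 0 ^ 2 - T) *
      ((∫ y, y.2 0 ^ 2 ∂((pinnedChain ω₂ lam β γ).transitionKernel (n + 1) T T t.toNNReal z)) -
        (∫ y, y.2 0 ∂((pinnedChain ω₂ lam β γ).transitionKernel (n + 1) T T t.toNNReal z)) ^ 2))
      ((pinnedChain ω₂ lam β γ).gibbsMeasure (n + 1) T) :=
    (hθG.sub hθm).congr (Eventually.of_forall fun z => by simp only [Pi.sub_apply]; ring)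
  rw [← integral_add hθm hV]
  exact integral_congr_ae (Eventually.of_forall fun z => by ring)

/-- ★ **CUMULANT CHANNEL SPLIT**: `κ_N(t) = SQ_N(t) + VC_N(t)` (`N ≥ 1`, every `t`). [this cell] -/
theorem bathCumulant_eq_staticCumulant_add_varChannel {N : ℕ} (hN : 0 < N) (t : ℝ) :
    bathCumulant ω₂ lam β γ T N t = bathStaticCumulant ω₂ lam β γ T N t + bathVarChannel ω₂ lam β γ T N t := by
  unfold bathCumulant bathStaticCumulant
  rw [bathKinCorr_eq_commonPast_add_varChannel hω hl hβ hγ hT hN t]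
  ring

/-- `VC_N(t) = K_N(t) − CP_N(t)` — the variance channel is measurable WITHOUT nesting from `K_N` and the two-replica functional `CP_N`. [formal bookkeeping] -/
theorem bathVarChannel_eq_sub {N : ℕ} (hN : 0 < N) (t : ℝ) :
    bathVarChannel ω₂ lam β γ T N t = bathKinCorr ω₂ lam β γ T N t - bathCommonPast ω₂ lam β γ T N t := by
  rw [bathKinCorr_eq_commonPast_add_varChannel hω hl hβ hγ hT hN t]; ring

end Moments

/-- ★ **HARMONIC CALIBRATION of the variance channel** (`lam = β = 0`, any `ω₂ > 0`, `γ ≥ 0`, `T > 0`, `N ≥ 1`, every `t`): the conditional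
variance of the boundary momentum forecast `V_t(z) = P_t p₀²(z) − (P_t p₀(z))² ≡ v(t)` does NOT depend on the microstate `z` (the harmonic kernel is the
flow-shifted kernel from `0`: `harmonic_kernel_momentum`, `harmonic_kernel_momentum_sq`), hence `VC_N(t) = v(t)·∫(p₀² − T)dμ_T = 0`.  The variance
channel therefore carries NO phonon contribution at all: whatever it measures at `lam > 0` is anharmonic transport. [this cell] -/
theorem bathVarChannel_harmonic_eq_zero {ω₂ γ T : ℝ} (hω : 0 < ω₂) (hγ : 0 ≤ γ) (hT : 0 < T) {N : ℕ} (hN : 0 < N) (t : ℝ) :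
    bathVarChannel ω₂ 0 0 γ T N t = 0 := by
  obtain ⟨n, rfl⟩ : ∃ n, N = n + 1 := ⟨N - 1, by omega⟩
  unfold bathVarChannel
  rw [dif_pos (Nat.succ_pos n)]
  set K := (pinnedChain ω₂ 0 0 γ).transitionKernel (n + 1) T T t.toNNReal with hK
  set v : ℝ := (∫ y, y.2 (0 : Fin (n + 1)) ^ 2 ∂K 0) - (∫ y, y.2 (0 : Fin (n + 1)) ∂K 0) ^ 2 with hv
  change ∫ z, (z.2 0 ^ 2 - T) * ((∫ y, y.2 0 ^ 2 ∂K z) - (∫ y, y.2 0 ∂K z) ^ 2)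
    ∂((pinnedChain ω₂ 0 0 γ).gibbsMeasure (n + 1) T) = 0
  have hV : ∀ z : PhaseSpace (n + 1), (∫ y, y.2 0 ^ 2 ∂K z) - (∫ y, y.2 0 ∂K z) ^ 2 = v := by
    intro z
    rw [hK, harmonic_kernel_momentum hω hγ (Nat.succ_pos n) hT t.toNNReal z 0,
      harmonic_kernel_momentum_sq hω hγ (Nat.succ_pos n) hT t.toNNReal z 0]
    ring
  simp_rw [hV]
  rw [integral_mul_const, pinnedChain_integral_kinObs_gibbsMeasure hω le_rfl le_rfl γ (n + 1) hT 0, zero_mul]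

end Summit.AtomisticToContinuum.FouriersLaw.Theorems.BoundedResponse.HeatSpreading
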